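/-
Origin: expansion seat `planner-pub-hodgecm-pv10-g3-0`, handover #8 2026-08-18T09:44:02Z (`HOME/pub-hodgecm-pv10-g3/lean/Pv10g3/GodementHyperbolic.lean`, md5 d775a0e5, 408 lines);
landed by the gen-7 packager in gate run 28 as `HodgeCM/PerL34/GodementHyperbolic.lean` (import ^import Pv10g3\.→import HodgeCM.PerL34. ×1).
-/
import Summits.HodgeConjecture.HodgeCM.PerL34.GodementSharp
import Literature.NumberTheory.Automorphic.AdicCompletionCompact

/-!
# Godement's criterion is sharp: the necessity half and the hyperbolic plane

`HodgeCM.PrintFact_unitaryCompact` (PRINT → KERNEL in `GodementCompact`) says: for `H` hermitian and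
ANISOTROPIC over a CM field `L`, the adelic quotient `U(H)(L⁺)\U(H)(𝔸_{L⁺})` is compact.
`GodementSharp` showed the hypothesis cannot be dropped (witness `H = 0`, a degenerate form).  This file
proves the genuinely sharp statement: anisotropy cannot even be weakened to NON-DEGENERACY.

Main results (all kernel-proved, no cited facts; closure `[propext, Classical.choice, Quot.sound]`):

* `exists_isCompact_mul_subgroup_eq` — a cocompact subgroup of a locally compact group has a compact
  set of coset representatives;
* `locallyCompactSpace_adelicUnitaryGroup` — `U(H)(𝔸_{L⁺})` is locally compact;
* `exists_matHeightBound_le_of_isCompact` — the operator height bound is bounded on compacta of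
  `M_n(𝔸_K)` (uniform integrality at almost all finite places, `RestrictedProduct.isOpen_forall_imp_mem`);
* `exists_vecHeight_floor_of_compactSpace` — **necessity half of Godement's criterion, height form**:
  if `U(H)(L⁺)\U(H)(𝔸_{L⁺})` is compact then `h(g ξ) ≥ c > 0` for all `g ∈ U(H)(𝔸)`, `ξ ∈ Lⁿ ∖ 0`
  (Godement, Sém. Bourbaki 257, §4; Platonov–Rapinchuk, Thm. 5.5, proof of necessity);
* `not_compactSpace_of_heightCollapse` — the collapse criterion;
* `hypTorus_mem`, `vecHeight_hypTorus_single` — the split torus `a(t) = diag(t, c(t)⁻¹)` of the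
  unitary group of the hyperbolic plane `(0 1; 1 0)` and `h(a(t) e₁) = ‖t‖_𝔸`;
* `not_compactSpace_hyperbolicPlane` — for EVERY CM field `L`, the adelic quotient of `U(0 1; 1 0)` is
  not compact;
* `HodgeCM.not_printFact_unitaryCompact_nondegenerate` — the variant of `PrintFact_unitaryCompact` with
  "anisotropic" replaced by "`det H ≠ 0`" is FALSE (witness `L = ℚ(ζ₇)`, `n = 2`).

Conventions: column action `g *ᵥ ξ_𝔸` as in `GodementCompact`; the vendored row-convention bounds are
transported along `Mahler.glTranspose`.
-/

open scoped NNReal Matrix MatrixGroups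
open NumberField IsDedekindDomain Literature.NumberTheory Literature.NumberTheory.Automorphic
open HodgeCM.Adelic Literature.AlgebraicGeometry.ShimuraVarieties

namespace HodgeCM.PerL34.Godement

section TopGroup

variable {G : Type*} [Group G] [TopologicalSpace G] [IsTopologicalGroup G]

/-- **Compact quotient ⇒ compact set of representatives**: if `G` is locally compact and `G ⧸ Γ` is compact,
there is a compact `K ⊆ G` with `K · Γ = G`. -/
theorem exists_isCompact_mul_subgroup_eq [LocallyCompactSpace G] (Γ : Subgroup G)
    [CompactSpace (G ⧸ Γ)] : ∃ K : Set G, IsCompact K ∧ ∀ g : G, ∃ k ∈ K, ∃ γ ∈ Γ, g = k * γ := by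
  classical
  -- open cover of `G ⧸ Γ` by the images of the interiors of compact neighbourhoods
  have hcov : (Set.univ : Set (G ⧸ Γ)) ⊆ ⋃ x : G, QuotientGroup.mk '' interior (Classical.choose
      (WeaklyLocallyCompactSpace.exists_compact_mem_nhds x)) := by
    intro q _
    obtain ⟨x, rfl⟩ := QuotientGroup.mk_surjective q
    refine Set.mem_iUnion.2 ⟨x, x, ?_, rfl⟩
    exact mem_interior_iff_mem_nhds.2
      (Classical.choose_spec (WeaklyLocallyCompactSpace.exists_compact_mem_nhds x)).2
  have hopen : ∀ x : G, IsOpen (QuotientGroup.mk '' interior (Classical.choose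
      (WeaklyLocallyCompactSpace.exists_compact_mem_nhds x)) : Set (G ⧸ Γ)) :=
    fun x => QuotientGroup.isOpenMap_coe _ isOpen_interior
  obtain ⟨t, ht⟩ := isCompact_univ.elim_finite_subcover _ hopen hcov
  refine ⟨⋃ x ∈ t, Classical.choose (WeaklyLocallyCompactSpace.exists_compact_mem_nhds x),
    t.isCompact_biUnion fun x _ =>
      (Classical.choose_spec (WeaklyLocallyCompactSpace.exists_compact_mem_nhds x)).1, fun g => ?_⟩
  obtain ⟨x, hxt, hx⟩ : ∃ x ∈ t, (QuotientGroup.mk g : G ⧸ Γ) ∈ QuotientGroup.mk '' interior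
      (Classical.choose (WeaklyLocallyCompactSpace.exists_compact_mem_nhds x)) := by
    simpa only [Set.mem_iUnion, exists_prop] using ht (Set.mem_univ _)
  obtain ⟨k, hk, hkg⟩ := hx
  refine ⟨k, Set.mem_biUnion hxt (interior_subset hk), k⁻¹ * g, ?_, by group⟩
  rw [← QuotientGroup.eq]; exact hkg

end TopGroup

variable (L : Type) [Field L] [NumberField L] [IsCMField L] {n : ℕ}

local notation "𝔸L" => AdeleRing (𝓞 L) L

omit [IsCMField L] in
/-- `GL_n(𝔸_L)` is locally compact. -/
theorem locallyCompactSpace_GL : LocallyCompactSpace (GL (Fin n) 𝔸L) := by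
  haveI : LocallyCompactSpace 𝔸L := locallyCompactSpace_adeleRing' L
  haveI : LocallyCompactSpace (Matrix (Fin n) (Fin n) 𝔸L) :=
    inferInstanceAs (LocallyCompactSpace (Fin n → Fin n → 𝔸L))
  infer_instance

/-- `U(H)(𝔸_{L⁺})` is locally compact (closed in `GL_n(𝔸_L)`). -/
theorem locallyCompactSpace_adelicUnitaryGroup (H : Matrix (Fin n) (Fin n) L) :
    LocallyCompactSpace (adelicUnitaryGroup L H) := by
  haveI := locallyCompactSpace_GL L (n := n)
  exact (isClosed_adelicUnitaryGroup L H).locallyCompactSpace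

/-- Compact adelic quotient ⇒ `U(H)(𝔸) = K · U(H)(L⁺)` for a compact `K`. -/
theorem exists_isCompact_mul_rat (H : Matrix (Fin n) (Fin n) L)
    [CompactSpace (adelicUnitaryGroup L H ⧸ adelicUnitaryRat L H)] :
    ∃ K : Set (adelicUnitaryGroup L H), IsCompact K ∧
      ∀ g : adelicUnitaryGroup L H, ∃ k ∈ K, ∃ γ ∈ adelicUnitaryRat L H, g = k * γ := by
  haveI := locallyCompactSpace_adelicUnitaryGroup L H
  exact exists_isCompact_mul_subgroup_eq _

end HodgeCM.PerL34.Godement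

namespace HodgeCM.PerL34.Godement

section FiniteAdele

variable {K : Type*} [Field K] [NumberField K]

/-- **Compact sets of finite adeles are uniformly almost integral**: a compact `D ⊆ 𝔸_K^∞` lies in
`∏_{v ∈ T} K_v × ∏_{v ∉ T} 𝒪_v` for one finite `T`. -/
theorem exists_finset_forall_mem_integers_of_isCompact {D : Set (FiniteAdeleRing (𝓞 K) K)}
    (hD : IsCompact D) : ∃ T : Finset (HeightOneSpectrum (𝓞 K)),
      ∀ x ∈ D, ∀ v, v ∉ T → x v ∈ v.adicCompletionIntegers K := by
  classical
  have hAopen : ∀ v : HeightOneSpectrum (𝓞 K),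
      IsOpen (v.adicCompletionIntegers K : Set (v.adicCompletion K)) :=
    fun _ => Valued.isOpen_valuationSubring _
  -- the directed open cover `U_T = {x | ∀ v ∉ T, x_v ∈ 𝒪_v}`
  let U : Finset (HeightOneSpectrum (𝓞 K)) → Set (FiniteAdeleRing (𝓞 K) K) :=
    fun T => {x | ∀ v, v ∉ T → x v ∈ v.adicCompletionIntegers K}
  have hU : ∀ T, IsOpen (U T) := fun T =>
    RestrictedProduct.isOpen_forall_imp_mem hAopen (p := fun v => v ∉ T)
  have hcov : D ⊆ ⋃ T, U T := by
    intro x _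
    have hx : ∀ᶠ v in Filter.cofinite, x v ∈ v.adicCompletionIntegers K := x.2
    refine Set.mem_iUnion.2 ⟨(Filter.eventually_cofinite.1 hx).toFinset, fun v hv => ?_⟩
    by_contra h
    exact hv (Set.Finite.mem_toFinset _ |>.2 h)
  obtain ⟨t, ht⟩ := hD.elim_finite_subcover U hU hcov
  refine ⟨t.sup id, fun x hx v hv => ?_⟩
  obtain ⟨T, hTt, hxT⟩ : ∃ T ∈ t, x ∈ U T := by
    simpa only [Set.mem_iUnion, exists_prop] using ht hx
  exact hxT v fun hvT => hv (Finset.mem_sup.2 ⟨T, hTt, hvT⟩)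

end FiniteAdele

end HodgeCM.PerL34.Godement

namespace HodgeCM.PerL34.Godement

section MatHeightBound

variable {K : Type} [Field K] [NumberField K] {ι κ : Type*} [Fintype ι] [Fintype κ]

omit [Fintype ι] [Fintype κ] in
/-- (Ported verbatim from the HodgeCMPerL package; no docstring in the source.) -/
theorem continuous_matrix_entry_arch (w : InfinitePlace K) (i : ι) (j : κ) :
    Continuous fun M : Matrix ι κ (AdeleRing (𝓞 K) K) => (M i j).1 w :=
  (continuous_apply w).comp (continuous_fst.comp ((continuous_apply j).comp (continuous_apply i)))

omit [Fintype ι] [Fintype κ] in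
/-- (Ported verbatim from the HodgeCMPerL package; no docstring in the source.) -/
theorem continuous_matrix_entry_fin (v : HeightOneSpectrum (𝓞 K)) (i : ι) (j : κ) :
    Continuous fun M : Matrix ι κ (AdeleRing (𝓞 K) K) => (M i j).2 v :=
  (RestrictedProduct.continuous_eval v).comp
    (continuous_snd.comp ((continuous_apply j).comp (continuous_apply i)))

/-- (Ported verbatim from the HodgeCMPerL package; no docstring in the source.) -/
theorem continuous_matArchBound (w : InfinitePlace K) :
    Continuous fun M : Matrix ι κ (AdeleRing (𝓞 K) K) => matArchBound K w M := by
  unfold matArchBound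
  exact NNReal.continuous_sqrt.comp (continuous_finsetSum _ fun ij _ =>
    (continuous_nnnorm.comp (continuous_matrix_entry_arch w ij.1 ij.2)).pow 2)

/-- **The height bound of a matrix is bounded on compact sets of adelic matrices.** -/
theorem exists_matHeightBound_le_of_isCompact {C : Set (Matrix ι κ (AdeleRing (𝓞 K) K))}
    (hC : IsCompact C) : ∃ B : ℝ≥0, ∀ M ∈ C, matHeightBound K M ≤ B := by
  classical
  -- archimedean part: continuous, hence bounded on `C`
  have harch : ∀ w : InfinitePlace K, ∃ A : ℝ≥0, ∀ M ∈ C, matArchBound K w M ≤ A := by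
    intro w
    obtain ⟨A, hA⟩ := (hC.image (continuous_matArchBound w)).bddAbove
    exact ⟨A, fun M hM => hA (Set.mem_image_of_mem _ hM)⟩
  choose A hA using harch
  -- finite part: one finite set of places outside which every entry of every `M ∈ C` is integral
  have hT : ∀ ij : ι × κ, ∃ T : Finset (HeightOneSpectrum (𝓞 K)), ∀ M ∈ C, ∀ v, v ∉ T →
      (M ij.1 ij.2).2 v ∈ v.adicCompletionIntegers K := by
    intro ij
    have hD : IsCompact ((fun M : Matrix ι κ (AdeleRing (𝓞 K) K) => (M ij.1 ij.2).2) '' C) :=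
      hC.image (continuous_snd.comp ((continuous_apply ij.2).comp (continuous_apply ij.1)))
    obtain ⟨T, hT⟩ := exists_finset_forall_mem_integers_of_isCompact hD
    exact ⟨T, fun M hM v hv => hT _ (Set.mem_image_of_mem _ hM) v hv⟩
  choose T hT using hT
  -- at the finitely many remaining places: each entry norm is continuous, hence bounded
  have hB : ∀ v : HeightOneSpectrum (𝓞 K), ∃ Bv : ℝ≥0, ∀ M ∈ C, matFinBound K v M ≤ Bv := by
    intro v
    have hent : ∀ ij : ι × κ, ∃ b : ℝ≥0, ∀ M ∈ C, ‖(M ij.1 ij.2).2 v‖₊ ≤ b := by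
      intro ij
      obtain ⟨b, hb⟩ := (hC.image
        (continuous_nnnorm.comp (continuous_matrix_entry_fin v ij.1 ij.2))).bddAbove
      exact ⟨b, fun M hM => hb (Set.mem_image_of_mem _ hM)⟩
    choose b hb using hent
    refine ⟨Finset.univ.sup b, fun M hM => Finset.sup_le fun ij _ => ?_⟩
    exact (hb ij M hM).trans (Finset.le_sup (f := b) (Finset.mem_univ ij))
  choose Bf hBf using hB
  set Tall : Finset (HeightOneSpectrum (𝓞 K)) := Finset.univ.sup T with hTall
  refine ⟨(∏ w : InfinitePlace K, A w ^ w.mult) * ∏ v ∈ Tall, (1 ⊔ Bf v), fun M hM => ?_⟩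
  have hsupp : (Function.mulSupport fun v => 1 ⊔ matFinBound K v M) ⊆ Tall := by
    intro v hv
    by_contra hvT
    apply hv
    have hle : matFinBound K v M ≤ 1 := by
      refine Finset.sup_le fun ij _ => ?_
      have hmem : (M ij.1 ij.2).2 v ∈ v.adicCompletionIntegers K :=
        hT ij M hM v fun h => hvT (Finset.mem_sup.2 ⟨ij, Finset.mem_univ _, h⟩)
      rw [← NNReal.coe_le_coe, coe_nnnorm, NNReal.coe_one]
      exact Valued.toNormedField.norm_le_one_iff.2 hmem
    simp [sup_eq_left.2 hle]
  rw [matHeightBound, finprod_eq_prod_of_mulSupport_subset _ hsupp]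
  refine mul_le_mul' (Finset.prod_le_prod' fun w _ => ?_) (Finset.prod_le_prod' fun v _ => ?_)
  · exact pow_le_pow_left' (hA w M hM) _
  · exact sup_le_sup_left (hBf v M hM) 1

end MatHeightBound

end HodgeCM.PerL34.Godement

namespace HodgeCM.PerL34.Godement

section Floor

variable {K : Type} [Field K] [NumberField K] {n : ℕ}

/-- **Height floor on a compact set** (column convention): for a compact `C ⊆ GL_n(𝔸_K)` there is
`c > 0` with `c ≤ h(g ξ)` for all `g ∈ C` and all `ξ ∈ Kⁿ ∖ 0`. -/
theorem exists_vecHeight_floor_of_isCompact {C : Set (GL (Fin n) (AdeleRing (𝓞 K) K))}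
    (hC : IsCompact C) : ∃ c : ℝ≥0, 0 < c ∧ ∀ g ∈ C, ∀ ξ : Fin n → K, ξ ≠ 0 →
      c ≤ vecHeight K ((g : Matrix (Fin n) (Fin n) (AdeleRing (𝓞 K) K)) *ᵥ principalVec K ξ) := by
  -- the compact set `{((gᵀ)⁻¹ : matrix) | g ∈ C}`
  have hC' : IsCompact ((fun g : GL (Fin n) (AdeleRing (𝓞 K) K) =>
      (((Mahler.glTranspose g)⁻¹ : GL (Fin n) (AdeleRing (𝓞 K) K)) :
        Matrix (Fin n) (Fin n) (AdeleRing (𝓞 K) K))) '' C) :=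
    hC.image (Units.continuous_val.comp (continuous_inv.comp Mahler.continuous_glTranspose))
  obtain ⟨B, hB⟩ := exists_matHeightBound_le_of_isCompact hC'
  have hM : (1 ⊔ B) ≠ 0 := ne_of_gt (lt_of_lt_of_le zero_lt_one le_sup_left)
  refine ⟨(1 ⊔ B)⁻¹, inv_pos.mpr (pos_of_ne_zero hM), fun g hg ξ hξ => ?_⟩
  have h1 := one_le_matHeightBound_mul_vecHeight (K := K) hξ (Mahler.glTranspose g)
  rw [Mahler.vecMul_glTranspose] at h1
  have hBg : matHeightBound K (((Mahler.glTranspose g)⁻¹ : GL (Fin n) (AdeleRing (𝓞 K) K)) :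
      Matrix (Fin n) (Fin n) (AdeleRing (𝓞 K) K)) ≤ 1 ⊔ B :=
    (hB _ (Set.mem_image_of_mem _ hg)).trans le_sup_right
  refine (NNReal.inv_le hM).mpr ?_
  exact h1.trans (mul_le_mul_left hBg _)

end Floor

variable (L : Type) [Field L] [NumberField L] [IsCMField L] {n : ℕ}

local notation "𝔸L" => AdeleRing (𝓞 L) L

omit [IsCMField L] in
/-- `principalVec` commutes with rational matrices (column form): `γ_𝔸 · ξ_𝔸 = (γ ξ)_𝔸`. -/
theorem map_mulVec_principalVec (γ : Matrix (Fin n) (Fin n) L) (ξ : Fin n → L) :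
    γ.map (algebraMap L 𝔸L) *ᵥ principalVec L ξ = principalVec L (γ *ᵥ ξ) := by
  funext i
  exact (RingHom.map_mulVec (algebraMap L 𝔸L) γ ξ i).symm

omit [NumberField L] [IsCMField L] in
/-- (Ported verbatim from the HodgeCMPerL package; no docstring in the source.) -/
theorem mulVec_ne_zero_of_GL (γ : GL (Fin n) L) {ξ : Fin n → L} (hξ : ξ ≠ 0) :
    (γ : Matrix (Fin n) (Fin n) L) *ᵥ ξ ≠ 0 := by
  intro h
  apply hξ
  have : ξ = ((γ⁻¹ : GL (Fin n) L) : Matrix (Fin n) (Fin n) L) *ᵥ ((γ : Matrix (Fin n) (Fin n) L) *ᵥ ξ) := by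
    rw [Matrix.mulVec_mulVec, ← Units.val_mul, inv_mul_cancel, Units.val_one, Matrix.one_mulVec]
  rw [this, h, Matrix.mulVec_zero]

/-- **Compact adelic quotient ⇒ height floor on the whole group**: if `U(H)(L⁺)\U(H)(𝔸)` is
compact then `h(g ξ) ≥ c > 0` for all `g ∈ U(H)(𝔸)` and `ξ ∈ Lⁿ ∖ 0` (write `g = k γ` with `k` in a
compact set and `γ` principal: `g ξ = k (γ ξ)`). -/
theorem exists_vecHeight_floor_of_compactSpace (H : Matrix (Fin n) (Fin n) L)
    [CompactSpace (adelicUnitaryGroup L H ⧸ adelicUnitaryRat L H)] :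
    ∃ c : ℝ≥0, 0 < c ∧ ∀ g ∈ adelicUnitaryGroup L H, ∀ ξ : Fin n → L, ξ ≠ 0 →
      c ≤ vecHeight L ((g : Matrix (Fin n) (Fin n) 𝔸L) *ᵥ principalVec L ξ) := by
  obtain ⟨K, hK, hKmul⟩ := exists_isCompact_mul_rat L H
  obtain ⟨c, hc, hfloor⟩ := exists_vecHeight_floor_of_isCompact (K := L)
    (hK.image continuous_subtype_val)
  refine ⟨c, hc, fun g hg ξ hξ => ?_⟩
  obtain ⟨k, hk, γ, hγ, hgk⟩ := hKmul ⟨g, hg⟩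
  obtain ⟨γ₀, -, hγ₀⟩ := (mem_adelicUnitaryRat_iff L H γ).1 hγ
  have hval : (g : Matrix (Fin n) (Fin n) 𝔸L) =
      ((k : GL (Fin n) 𝔸L) : Matrix (Fin n) (Fin n) 𝔸L) * ((γ₀ : Matrix (Fin n) (Fin n) L).map (algebraMap L 𝔸L)) := by
    have h1 := congrArg (fun x : adelicUnitaryGroup L H => ((x : GL (Fin n) 𝔸L) : Matrix (Fin n) (Fin n) 𝔸L)) hgk
    simp only [Subgroup.coe_mul, Units.val_mul] at h1
    rw [h1, ← hγ₀, val_toAdeleGL]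
  rw [hval, ← Matrix.mulVec_mulVec, map_mulVec_principalVec]
  exact hfloor _ (Set.mem_image_of_mem _ hk) _ (mulVec_ne_zero_of_GL L γ₀ hξ)

/-- **The collapse criterion**: if for one `ξ₀ ∈ Lⁿ ∖ 0` the heights `h(g ξ₀)`, `g ∈ U(H)(𝔸)`, come
arbitrarily close to `0`, then `U(H)(L⁺)\U(H)(𝔸_{L⁺})` is not compact. -/
theorem not_compactSpace_of_heightCollapse (H : Matrix (Fin n) (Fin n) L) {ξ₀ : Fin n → L}
    (hξ₀ : ξ₀ ≠ 0)
    (hcollapse : ∀ ε : ℝ≥0, 0 < ε → ∃ g ∈ adelicUnitaryGroup L H,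
      vecHeight L ((g : Matrix (Fin n) (Fin n) 𝔸L) *ᵥ principalVec L ξ₀) < ε) :
    ¬ CompactSpace (adelicUnitaryGroup L H ⧸ adelicUnitaryRat L H) := by
  intro hc
  obtain ⟨c, hcpos, hfloor⟩ := exists_vecHeight_floor_of_compactSpace L H
  obtain ⟨g, hg, hlt⟩ := hcollapse c hcpos
  exact (not_lt.2 (hfloor g hg ξ₀ hξ₀)) hlt

end HodgeCM.PerL34.Godement

namespace HodgeCM.PerL34.Godement

section Hyperbolic

variable (L : Type) [Field L] [NumberField L] [IsCMField L]

local notation "𝔸L" => AdeleRing (𝓞 L) L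

/-- `c ⊗ id` is an involution of `𝔸_L`. -/
theorem adeleConj_adeleConj (x : 𝔸L) : adeleConj L (adeleConj L x) = x := by
  have h : IsCMField.complexConj L * IsCMField.complexConj L = 1 :=
    AlgEquiv.ext fun y => by
      rw [AlgEquiv.mul_apply, AlgEquiv.one_apply, IsCMField.complexConj_apply_apply]
  rw [adeleConj_apply, adeleConj_apply, smul_smul, h, one_smul]

/-- The hyperbolic plane `H = (0 1; 1 0)`: hermitian, non-degenerate and isotropic. -/
def hyperbolicPlane : Matrix (Fin 2) (Fin 2) L := !![0, 1; 1, 0]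

/-- (Ported verbatim from the HodgeCMPerL package; no docstring in the source.) -/
theorem hyperbolicPlane_isHermitian (i j : Fin 2) :
    conjRingHomK L (hyperbolicPlane L i j) = hyperbolicPlane L j i := by
  fin_cases i <;> fin_cases j <;> simp [hyperbolicPlane]

omit [NumberField L] [IsCMField L] in
/-- (Ported verbatim from the HodgeCMPerL package; no docstring in the source.) -/
theorem det_hyperbolicPlane : (hyperbolicPlane L).det = -1 := by
  simp [hyperbolicPlane, Matrix.det_fin_two_of]

/-- (Ported verbatim from the HodgeCMPerL package; no docstring in the source.) -/
theorem hyperbolicPlane_isotropic :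
    hermForm (conjRingHomK L) (hyperbolicPlane L) (Pi.single 0 1) (Pi.single 0 1) = 0 := by
  simp [hermForm, hyperbolicPlane, Matrix.mulVec, dotProduct]

/-- (Ported verbatim from the HodgeCMPerL package; no docstring in the source.) -/
theorem not_isAnisotropic_hyperbolicPlane :
    ¬ ∀ x : Fin 2 → L, hermForm (conjRingHomK L) (hyperbolicPlane L) x x = 0 → x = 0 := by
  intro h
  have h1 : (Pi.single 0 1 : Fin 2 → L) 0 = 0 := by rw [h _ (hyperbolicPlane_isotropic L)]; rfl
  have h2 : (1 : L) = 0 := by simpa using h1.symm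
  exact one_ne_zero h2

/-- Diagonal elements of `GL_m(R)` with unit entries. -/
def diagGL {R : Type} [CommRing R] {m : ℕ} (d : Fin m → Rˣ) : GL (Fin m) R where
  val := Matrix.diagonal fun i => (d i : R)
  inv := Matrix.diagonal fun i => ((d i)⁻¹ : Rˣ)
  val_inv := by
    rw [Matrix.diagonal_mul_diagonal, ← Matrix.diagonal_one]
    exact congrArg Matrix.diagonal (funext fun i => Units.mul_inv (d i))
  inv_val := by
    rw [Matrix.diagonal_mul_diagonal, ← Matrix.diagonal_one]
    exact congrArg Matrix.diagonal (funext fun i => Units.inv_mul (d i))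

/-- (Ported verbatim from the HodgeCMPerL package; no docstring in the source.) -/
@[simp] theorem coe_diagGL {R : Type} [CommRing R] {m : ℕ} (d : Fin m → Rˣ) :
    (diagGL d : Matrix (Fin m) (Fin m) R) = Matrix.diagonal fun i => (d i : R) := rfl

/-- The split torus of `U(0 1; 1 0)`: `a(t) = diag(t, c(t)⁻¹)`, `t ∈ 𝔸_Lˣ`. -/
noncomputable def hypTorus (t : (𝔸L)ˣ) : GL (Fin 2) 𝔸L :=
  diagGL ![t, Units.map (adeleConj L : 𝔸L →+* 𝔸L).toMonoidHom t⁻¹]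

/-- (Ported verbatim from the HodgeCMPerL package; no docstring in the source.) -/
theorem hypTorus_mem (t : (𝔸L)ˣ) : hypTorus L t ∈ adelicUnitaryGroup L (hyperbolicPlane L) := by
  rw [mem_adelicUnitaryGroup_iff]
  have hc1 : adeleConj L (t : 𝔸L) * adeleConj L ((t⁻¹ : (𝔸L)ˣ) : 𝔸L) = 1 := by
    rw [← map_mul, Units.mul_inv, map_one]
  have hc2 : adeleConj L (adeleConj L ((t⁻¹ : (𝔸L)ˣ) : 𝔸L)) * (t : 𝔸L) = 1 := by
    rw [adeleConj_adeleConj, Units.inv_mul]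
  ext i j
  rw [hypTorus, coe_diagGL, Matrix.diagonal_map (map_zero _), Matrix.diagonal_transpose,
    Matrix.mul_diagonal, Matrix.diagonal_mul, Matrix.map_apply]
  fin_cases i <;> fin_cases j <;> simp [hyperbolicPlane, hc1, hc2]

omit [IsCMField L] in
/-- (Ported verbatim from the HodgeCMPerL package; no docstring in the source.) -/
theorem hypTorus_mulVec_single (t : (𝔸L)ˣ) [IsCMField L] :
    (hypTorus L t : Matrix (Fin 2) (Fin 2) 𝔸L) *ᵥ principalVec L (Pi.single 0 1) =
      Pi.single 0 (t : 𝔸L) := by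
  rw [principalVec_single, map_one, hypTorus, coe_diagGL, Matrix.diagonal_mulVec_single, mul_one]
  rfl

/-- Heights collapse along the split torus: `h(a(t) e₁) = ‖t‖_𝔸`. -/
theorem vecHeight_hypTorus_single (t : (𝔸L)ˣ) :
    vecHeight L ((hypTorus L t : Matrix (Fin 2) (Fin 2) 𝔸L) *ᵥ principalVec L (Pi.single 0 1)) =
      IdeleClassGroup.ideleNorm L t := by
  rw [hypTorus_mulVec_single, vecHeight_single]


-- port_pkg: scope closed for this part
end Hyperbolic
end HodgeCM.PerL34.Godement
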